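import Summits.ResolutionOfSingularities.ResolutionOfSingularities.Theorems.EquisingularLiftEquisingularLiftNatGEPrincipalUnique
import Summits.ResolutionOfSingularities.ResolutionOfSingularities.Theorems.EquisingularLiftEquisingularLiftNatGEPrincipalThickenings
import Literature.AlgebraicGeometry.FormalGeometry.FormalNeighbourhoodTower
import Literature.AlgebraicGeometry.Resolution.FormalRetractionSection
import HarnessLib

/-!
# [OURS · L1 W4.5(b) · EL♮(3) · F-88 phase 3] **F-88 AS A THEOREM, GENERAL IDEAL OF DEFINITION**: Grothendieck's existence theorem for
# closed formal subschemes (Görtz–Wedhorn II Prop. 24.109 / EGA III₁ Cor. 5.1.8) — `GrothendieckExistence_holds : GrothendieckExistence`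

Crux chain w45b (cell `res-hironaka`, slot W4.5(b)), working crux **EL♮** = stmt-ResolutionOfSingularities-20038, child **EL♮(3)** =
stmt-ResolutionOfSingularities-20148, route EquisingularLift, line `sections`; FACT-LIST row F-88 (`Literature.AlgebraicGeometry.FormalGeometry.GrothendieckExistence`,
the NEED-FACT stub `stub_elnat_grothendieckExistence` of the 23rd–44th registered texts, RETIRED by the 45th over E♭). Written by res-type-027 g23
(phase 3 of INPUTS ADDENDUM 8 §2 / res-inputs-crit-1 R186 «F-88 general ideal ⇐ principal case: E♭ ∧ U♭ + induction on generators»), after E♭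
(✓ `…NatGEPrincipalThickenings`) and U♭ (✓ `…NatGEPrincipalUnique`). HONEST FRAMING: OURS glue (the dévissage is folklore: EGA III₁ §5.1 proves the
general case directly) around PUBLISHED theorems that are ALREADY KERNEL THEOREMS in the tree (GW II Thm. 24.94 along one global function,
`FormalGeometry/WittGEUnitBoundStepII`; Cor. 24.100, `Morphisms/FormalModuleHomCoh`; «a noetherian ring complete for `I` is complete for `J ⊆ I`»,
`Resolution/FormalRetractionSection`); nothing of H. Hironaka's 2017 manuscript is involved or attributed; AI-written, gate-checked, weaker than
expert review. No `sorry`; standard axioms; DEF-FREE apart from the transparent abbreviation `extIdeal` (`J·𝒪_X`).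
`--supports stmt-ResolutionOfSingularities-20148 --as helper`; `ledger fact claim …GrothendieckExistence` (027 g23).

RESULTS (namespace `…Sections.GEPrincipal` unless absolute).
* `existsUnique_idealSheaf_forall_eq_sup_finset f s (hc : IsAdicComplete (span s) A) K hK : ∃! K', ∀ n, K n = K' ⊔ (s·𝒪_X)ⁿ⁺¹` and
  `existsUnique_idealSheaf_forall_eq_sup_extIdeal f I [IsAdicComplete I A] K hK` — Grothendieck existence AND uniqueness for closed formal
  subschemes in ideal-sheaf form, ANY ideal of definition `I` of the noetherian `I`-complete `A`, `X` proper over `A`;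
* `grothendieckExistence_general` — F-88's body VERBATIM (`(I : Ideal A) [IsAdicComplete I A]`, Mathlib `infinitesimalNeighbourhood` thickenings,
  cartesian `IsPullback` squares), PROVED; `grothendieckExistence_holds : GrothendieckExistence.{u}`;
* **`Literature.AlgebraicGeometry.FormalGeometry.GrothendieckExistence_holds`** — the named fact DISCHARGED under its canonical name.

PROOF (induction on a finite generating set `s` of `I`, `Finset.induction_on`, everything on the FIXED `X` over the FIXED `A`; motive = existence
∧ uniqueness). `s = ∅`: `(∅·𝒪_X)ⁿ⁺¹ = ⊥`, the system is constant. `s ↦ insert a s` (`I = (a) + (s)`, `𝔞 := (α)`, `𝔰 := s·𝒪_X`, `A` is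
`(s)`- and `(a)`-complete by `IsAdicComplete.of_le_of_isNoetherianRing`): for each `m` the system `L⁽ᵐ⁾_n := K_{m+n+1} + 𝔞ᵐ⁺¹ + 𝔰ⁿ⁺¹`
(`= K_N + 𝔞ᵐ⁺¹ + 𝔰ⁿ⁺¹` for every `N ≥ m+n+1`, since `(𝔞 + 𝔰)^{m+n+2} ≤ 𝔞ᵐ⁺¹ + 𝔰ⁿ⁺¹`, Mathlib `Ideal.sup_pow_add_le_pow_sup_pow`) is an
`𝔰`-system; the induction hypothesis gives a UNIQUE `M_m` with `L⁽ᵐ⁾_n = M_m + 𝔰ⁿ⁺¹`; uniqueness forces `M_m = M_{m+1} + 𝔞ᵐ⁺¹` (both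
algebraize `L⁽ᵐ⁾`), so `(M_m)` is an `𝔞`-system and E♭ + U♭ (`existsUnique_idealSheaf_forall_eq_sup`) give a unique `K'` with
`M_m = K' + 𝔞ᵐ⁺¹`; then `K_n = K_{2n+1} + (𝔞+𝔰)ⁿ⁺¹` and `K_{2n+1} ≤ L⁽ⁿ⁾_n = K' + 𝔞ⁿ⁺¹ + 𝔰ⁿ⁺¹ ≤ K_n` give `K_n = K' + (𝔞+𝔰)ⁿ⁺¹`;
uniqueness: a second `K''` has `K'' + 𝔞ᵐ⁺¹` algebraizing `L⁽ᵐ⁾`, hence `= M_m`, hence `K'' = K'` by U♭. The scheme-language assembly is the one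
of E♭ (`…NatGEPrincipalThickenings`) with `ker_ι_eq_extIdeal_pow : 𝓘(X ×_A A/Iⁿ⁺¹ ↪ X) = (I·𝒪_X)ⁿ⁺¹` for the general `I`.
WHY PROPERNESS / COMPLETENESS MATTER: over `𝔸¹_{ℤ_p}` the formal subscheme of `(1 - px)` is empty modulo every `pⁿ⁺¹`; on an affine curve
over `ℤ_p` a transcendental formal section does not algebraize (lead-2's F88-ASSESSMENT (H0)) — both excluded by `IsProper f`.

References (method / index only): A. Grothendieck, EGA III₁ (1961), Thm. 5.1.4, Cor. 5.1.8; U. Görtz, T. Wedhorn, *Algebraic Geometry II*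
(2023), Thm. 24.94, Cor. 24.100, Prop. 24.109 (pp. 566–577); H. Matsumura, *Commutative Ring Theory*, Thm. 8.10/8.14; Stacks 0898, 089A, 090T.
-/

set_option linter.dupNamespace false -- mandated namespace `Summit.<Summit>.<Problem>` of this single-conjunct summit

noncomputable section

-- `TopCat.Presheaf`/`Scheme.Modules` are not reducible (as in Mathlib's `AlgebraicGeometry/Modules`).
set_option backward.isDefEq.respectTransparency false

open CategoryTheory CategoryTheory.Limits AlgebraicGeometry TopologicalSpace Opposite
open AlgebraicGeometry.Scheme.IdealSheafData
open Literature.AlgebraicGeometry.Modules Literature.AlgebraicGeometry.Morphisms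
open Literature.AlgebraicGeometry.Morphisms.infinitesimalNeighbourhood (ι toSpec transition transition_ι base)
open Literature.AlgebraicGeometry.FormalGeometry (idealSheaf_pow_mono idealSheaf_pow_succ_antitone)

universe u

namespace Summit.ResolutionOfSingularities.ResolutionOfSingularities.Cruxes.EquisingularLiftNat.Sections

namespace GEPrincipal

variable {X : Scheme.{u}}

/-! ### Ideal-sheaf arithmetic -/

/-- `ofIdealTop` preserves `⊔`. [folklore] -/
theorem ofIdealTop_sup (I J : Ideal Γ(X, ⊤)) : ofIdealTop (I ⊔ J) = ofIdealTop I ⊔ ofIdealTop J := by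
  refine Scheme.IdealSheafData.ext (funext fun U => ?_)
  rw [ofIdealTop_ideal, ideal_sup, Pi.sup_apply, ofIdealTop_ideal, ofIdealTop_ideal, Ideal.map_sup]

/-- `ofIdealTop ⊥ = ⊥`. [folklore] -/
theorem ofIdealTop_bot : ofIdealTop (⊥ : Ideal Γ(X, ⊤)) = ⊥ := by
  refine Scheme.IdealSheafData.ext (funext fun U => ?_)
  rw [ofIdealTop_ideal, ideal_bot, Pi.bot_apply, Ideal.map_bot]

/-- `⊥ⁿ⁺¹ = ⊥` for ideal sheaves. [folklore] -/
theorem bot_pow_succ (n : ℕ) : (⊥ : X.IdealSheafData) ^ (n + 1) = ⊥ := by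
  refine Scheme.IdealSheafData.ext (funext fun U => ?_)
  rw [ideal_pow, Pi.pow_apply, ideal_bot, Pi.bot_apply, ← Ideal.zero_eq_bot, zero_pow (Nat.succ_ne_zero n)]

/-- `(I + J)^(m+n) ≤ I^m + J^n` for ideal sheaves. [folklore] -/
theorem sup_pow_add_le (I J : X.IdealSheafData) (m n : ℕ) : (I ⊔ J) ^ (m + n) ≤ I ^ m ⊔ J ^ n :=
  Scheme.IdealSheafData.le_def.mpr fun U => by
    rw [ideal_pow, Pi.pow_apply, ideal_sup, Pi.sup_apply, ideal_sup, Pi.sup_apply, ideal_pow, ideal_pow,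
      Pi.pow_apply, Pi.pow_apply]
    exact Ideal.sup_pow_add_le_pow_sup_pow

section System

variable (𝔍 : X.IdealSheafData) (K : ℕ → X.IdealSheafData) (hK : ∀ n, K n = K (n + 1) ⊔ 𝔍 ^ (n + 1))

include hK in
/-- In a system `K_n = K_{n+1} + 𝔍ⁿ⁺¹`: `𝔍ⁿ⁺¹ ≤ K_n`. [folklore] -/
theorem pow_le_of_system (n : ℕ) : 𝔍 ^ (n + 1) ≤ K n := by
  rw [hK n]; exact le_sup_right

include hK in
/-- In a system `K_n = K_{n+1} + 𝔍ⁿ⁺¹`: `K_N ≤ K_n` for `n ≤ N`. [folklore] -/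
theorem antitone_of_system {n N : ℕ} (h : n ≤ N) : K N ≤ K n := by
  induction N, h using Nat.le_induction with
  | base => exact le_rfl
  | succ N _ ih => exact le_trans (by rw [hK N]; exact le_sup_left) ih

include hK in
/-- In a system `K_n = K_{n+1} + 𝔍ⁿ⁺¹`: `K_n = K_N + 𝔍ⁿ⁺¹` for `n ≤ N`. [folklore] -/
theorem eq_sup_of_system {n N : ℕ} (h : n ≤ N) : K n = K N ⊔ 𝔍 ^ (n + 1) := by
  induction N, h using Nat.le_induction with
  | base => exact le_antisymm le_sup_left (sup_le le_rfl (pow_le_of_system 𝔍 K hK n))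
  | succ N hnN ih =>
    rw [ih, hK N, sup_assoc]
    congr 1
    exact le_antisymm (sup_le (idealSheaf_pow_succ_antitone 𝔍 hnN) le_rfl) le_sup_right

end System

/-! ### The extension `J·𝒪_X` of an ideal `J ⊆ A` -/

section Ext

variable {A : Type u} [CommRing A] (f : X ⟶ Spec (.of A))

/-- **`J·𝒪_X`**: the ideal sheaf generated by an ideal `J ⊆ A` on an `A`-scheme `f : X → Spec A`. [folklore] -/
abbrev extIdeal (J : Ideal A) : X.IdealSheafData := ofIdealTop (J.map (algebraMapΓ f))

/-- `(J₁ + J₂)·𝒪_X = J₁·𝒪_X + J₂·𝒪_X`. [folklore] -/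
theorem extIdeal_sup (J₁ J₂ : Ideal A) : extIdeal f (J₁ ⊔ J₂) = extIdeal f J₁ ⊔ extIdeal f J₂ := by
  rw [extIdeal, Ideal.map_sup, ofIdealTop_sup]

/-- `(a)·𝒪_X = (α)`, `α = f♯a`. [folklore] -/
theorem extIdeal_span_singleton (a : A) : extIdeal f (Ideal.span {a}) = ofIdealTop (Ideal.span {algebraMapΓ f a}) := by
  rw [extIdeal, Ideal.map_span, Set.image_singleton]

/-- `⊥·𝒪_X = ⊥`. [folklore] -/
theorem extIdeal_bot : extIdeal f (⊥ : Ideal A) = ⊥ := by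
  rw [extIdeal, Ideal.map_bot, ofIdealTop_bot]

/-- The ideal of the thickening `X ×_A A/Iⁿ⁺¹ ↪ X` is `(I·𝒪_X)ⁿ⁺¹`. [folklore] -/
theorem ker_ι_eq_extIdeal_pow (I : Ideal A) (n : ℕ) : (ι I f n).ker = extIdeal f I ^ (n + 1) := by
  rw [ker_ι_eq, Ideal.map_pow, ofIdealTop_pow]

end Ext

/-! ### Existence and uniqueness for a finitely generated ideal of definition (induction on the generators) -/

section Induction

variable {A : Type u} [CommRing A] [IsNoetherianRing A] (f : X ⟶ Spec (.of A)) [IsProper f]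

/-- **Grothendieck existence for closed formal subschemes, ideal-sheaf form, for the ideal of definition generated by a
finite set `s`** — existence AND uniqueness of `K'` with `K_n = K' + (s·𝒪_X)ⁿ⁺¹`, by induction on `s`: for `s = insert a s'`
the systems `L⁽ᵐ⁾_n := K_{m+n+1} + (α)ᵐ⁺¹ + (s'·𝒪_X)ⁿ⁺¹` are `s'`-systems, their (unique) algebraizations `M_m` form an
`(a)`-system, whose algebraization (brick 2 + uniqueness) is the answer. [cite: GortzWedhorn2023, Prop. 24.109 (p. 577)] -/
theorem existsUnique_idealSheaf_forall_eq_sup_finset (s : Finset A)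
    (hc : IsAdicComplete (Ideal.span (s : Set A)) A) (K : ℕ → X.IdealSheafData)
    (hK : ∀ n, K n = K (n + 1) ⊔ extIdeal f (Ideal.span (s : Set A)) ^ (n + 1)) :
    ∃! K' : X.IdealSheafData, ∀ n, K n = K' ⊔ extIdeal f (Ideal.span (s : Set A)) ^ (n + 1) := by
  classical
  induction s using Finset.induction_on generalizing K with
  | empty =>
    have h0 : extIdeal f (Ideal.span ((∅ : Finset A) : Set A)) = ⊥ := by
      rw [Finset.coe_empty, Ideal.span_empty, extIdeal_bot]
    simp only [h0, bot_pow_succ, sup_bot_eq] at hK ⊢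
    have hconst : ∀ n, K n = K 0 := by
      intro n
      induction n with
      | zero => rfl
      | succ n ih => rw [← hK n, ih]
    exact ⟨K 0, hconst, fun K'' h => (h 0).symm⟩
  | insert a s has IH =>
    -- the two smaller ideals of definition, both adically complete
    haveI : IsAdicComplete (Ideal.span ((insert a s : Finset A) : Set A)) A := hc
    have hcs : IsAdicComplete (Ideal.span (s : Set A)) A :=
      Literature.AlgebraicGeometry.Resolution.IsAdicComplete.of_le_of_isNoetherianRing
        (Ideal.span ((insert a s : Finset A) : Set A)) _ (Ideal.span_mono (by simp))
    haveI : IsAdicComplete (Ideal.span {a}) A :=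
      Literature.AlgebraicGeometry.Resolution.IsAdicComplete.of_le_of_isNoetherianRing
        (Ideal.span ((insert a s : Finset A) : Set A)) _ (Ideal.span_mono (by simp))
    -- notation
    set 𝔞 : X.IdealSheafData := ofIdealTop (Ideal.span {algebraMapΓ f a}) with h𝔞
    set 𝔰 : X.IdealSheafData := extIdeal f (Ideal.span (s : Set A)) with h𝔰
    have h𝔍 : extIdeal f (Ideal.span ((insert a s : Finset A) : Set A)) = 𝔞 ⊔ 𝔰 := by
      rw [Finset.coe_insert, Ideal.span_insert, extIdeal_sup, extIdeal_span_singleton]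
    simp only [h𝔍] at hK ⊢
    have habs : ∀ m n, (𝔞 ⊔ 𝔰) ^ (m + n + 2) ≤ 𝔞 ^ (m + 1) ⊔ 𝔰 ^ (n + 1) := fun m n => by
      rw [show m + n + 2 = (m + 1) + (n + 1) by ring]; exact sup_pow_add_le 𝔞 𝔰 (m + 1) (n + 1)
    -- the `s`-systems `L m`
    let L : ℕ → ℕ → X.IdealSheafData := fun m n => K (m + n + 1) ⊔ 𝔞 ^ (m + 1) ⊔ 𝔰 ^ (n + 1)
    have hLN : ∀ m n N, m + n + 1 ≤ N → L m n = K N ⊔ 𝔞 ^ (m + 1) ⊔ 𝔰 ^ (n + 1) := by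
      intro m n N hN
      change K (m + n + 1) ⊔ 𝔞 ^ (m + 1) ⊔ 𝔰 ^ (n + 1) = _
      rw [eq_sup_of_system (𝔞 ⊔ 𝔰) K hK hN]
      refine le_antisymm (sup_le (sup_le (sup_le ?_ ?_) ?_) le_sup_right) ?_
      · exact le_sup_left.trans le_sup_left
      · exact (habs m n).trans (sup_le (le_sup_right.trans le_sup_left) le_sup_right)
      · exact le_sup_right.trans le_sup_left
      · exact sup_le (sup_le (le_sup_left.trans (le_sup_left.trans le_sup_left)) (le_sup_right.trans le_sup_left))
          le_sup_right
    have hL : ∀ m n, L m n = L m (n + 1) ⊔ 𝔰 ^ (n + 1) := by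
      intro m n
      rw [hLN m n (m + (n + 1) + 1) (by omega)]
      change K (m + (n + 1) + 1) ⊔ 𝔞 ^ (m + 1) ⊔ 𝔰 ^ (n + 1) =
        K (m + (n + 1) + 1) ⊔ 𝔞 ^ (m + 1) ⊔ 𝔰 ^ (n + 1 + 1) ⊔ 𝔰 ^ (n + 1)
      rw [sup_assoc (K _ ⊔ _), sup_eq_right.mpr (idealSheaf_pow_succ_antitone 𝔰 (Nat.le_succ n))]
    -- their unique algebraizations
    choose M hM hMu using fun m => IH hcs (L m) (hL m)
    have hMstep : ∀ m, M m = M (m + 1) ⊔ powIdeal (algebraMapΓ f a) m := by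
      intro m
      refine (hMu m _ fun n => ?_).symm
      have e1 : L m n = K (m + 1 + n + 1) ⊔ 𝔞 ^ (m + 1) ⊔ 𝔰 ^ (n + 1) := hLN m n (m + 1 + n + 1) (by omega)
      have e2 : M (m + 1) ⊔ 𝔰 ^ (n + 1) = K (m + 1 + n + 1) ⊔ 𝔞 ^ (m + 1 + 1) ⊔ 𝔰 ^ (n + 1) :=
        (hM (m + 1) n).symm
      change L m n = (M (m + 1) ⊔ 𝔞 ^ (m + 1)) ⊔ 𝔰 ^ (n + 1)
      rw [sup_right_comm, e2, e1]
      have ha : 𝔞 ^ (m + 1 + 1) ≤ 𝔞 ^ (m + 1) := idealSheaf_pow_succ_antitone 𝔞 (Nat.le_succ m)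
      refine le_antisymm (sup_le (sup_le ?_ le_sup_right) (le_sup_right.trans le_sup_left))
        (sup_le (sup_le (sup_le ?_ (ha.trans (le_sup_right.trans le_sup_left))) le_sup_right)
          (le_sup_right.trans le_sup_left))
      · exact le_sup_left.trans (le_sup_left.trans le_sup_left)
      · exact le_sup_left.trans le_sup_left
    -- the principal case: existence (brick 2) and uniqueness
    obtain ⟨K', hK', hK'u⟩ := existsUnique_idealSheaf_forall_eq_sup f a M hMstep
    refine ⟨K', fun n => ?_, fun K'' hK'' => ?_⟩
    · -- `K n = K' + (𝔞 + 𝔰)ⁿ⁺¹`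
      have h1 : K (n + n + 1) ≤ K' ⊔ 𝔞 ^ (n + 1) ⊔ 𝔰 ^ (n + 1) := by
        have : L n n = K' ⊔ 𝔞 ^ (n + 1) ⊔ 𝔰 ^ (n + 1) := by
          rw [hM n n, hK' n]
        rw [← this]
        exact le_sup_left.trans le_sup_left
      apply le_antisymm
      · rw [eq_sup_of_system (𝔞 ⊔ 𝔰) K hK (show n ≤ n + n + 1 by omega)]
        refine sup_le (h1.trans (sup_le (sup_le le_sup_left ?_) ?_)) le_sup_right
        · exact (idealSheaf_pow_mono le_sup_left _).trans le_sup_right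
        · exact (idealSheaf_pow_mono le_sup_right _).trans le_sup_right
      · refine sup_le ?_ (pow_le_of_system _ K hK n)
        have h2 : K' ≤ M n := by rw [hK' n]; exact le_sup_left
        have h3 : M n ≤ L n n := by rw [hM n n]; exact le_sup_left
        refine h2.trans (h3.trans (sup_le (sup_le ?_ ?_) ?_))
        · exact antitone_of_system _ K hK (by omega)
        · exact (idealSheaf_pow_mono le_sup_left _).trans (pow_le_of_system _ K hK n)
        · exact (idealSheaf_pow_mono le_sup_right _).trans (pow_le_of_system _ K hK n)
    · -- uniqueness
      have hM'' : ∀ m, K'' ⊔ powIdeal (algebraMapΓ f a) m = M m := by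
        intro m
        refine hMu m _ fun n => ?_
        change L m n = K'' ⊔ 𝔞 ^ (m + 1) ⊔ 𝔰 ^ (n + 1)
        change K (m + n + 1) ⊔ 𝔞 ^ (m + 1) ⊔ 𝔰 ^ (n + 1) = _
        rw [hK'' (m + n + 1)]
        refine le_antisymm (sup_le (sup_le (sup_le ?_ ?_) ?_) le_sup_right) ?_
        · exact le_sup_left.trans le_sup_left
        · exact (habs m n).trans (sup_le (le_sup_right.trans le_sup_left) le_sup_right)
        · exact le_sup_right.trans le_sup_left
        · exact sup_le (sup_le (le_sup_left.trans (le_sup_left.trans le_sup_left))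
            (le_sup_right.trans le_sup_left)) le_sup_right
      exact hK'u K'' fun m => (hM'' m).symm

/-- **Grothendieck existence for closed formal subschemes, ideal-sheaf form, GENERAL ideal of definition**: for `A`
noetherian and `I`-adically complete and `f : X ⟶ Spec A` proper, a system of quasi-coherent ideals `K_n = K_{n+1} + (I·𝒪_X)ⁿ⁺¹`
is `K_n = K' + (I·𝒪_X)ⁿ⁺¹` for a UNIQUE quasi-coherent ideal `K'`. [cite: GortzWedhorn2023, Prop. 24.109 (p. 577)] -/
theorem existsUnique_idealSheaf_forall_eq_sup_extIdeal (I : Ideal A) [IsAdicComplete I A]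
    (K : ℕ → X.IdealSheafData) (hK : ∀ n, K n = K (n + 1) ⊔ extIdeal f I ^ (n + 1)) :
    ∃! K' : X.IdealSheafData, ∀ n, K n = K' ⊔ extIdeal f I ^ (n + 1) := by
  obtain ⟨s, hs⟩ := IsNoetherian.noetherian I
  have hs' : I = Ideal.span (s : Set A) := hs.symm
  subst hs'
  exact existsUnique_idealSheaf_forall_eq_sup_finset f s inferInstance K hK

end Induction

/-! ### F-88 as a theorem -/

section Main

open Literature.AlgebraicGeometry.Resolution (comap_map_of_isClosedImmersion)

/-- **F-88 AS A THEOREM — Grothendieck's existence theorem for closed formal subschemes (Görtz–Wedhorn II Prop. 24.109 / EGA III₁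
Cor. 5.1.8), GENERAL ideal of definition**: literally the body of `Literature.AlgebraicGeometry.FormalGeometry.GrothendieckExistence`.
[cite: GortzWedhorn2023, Prop. 24.109 (p. 577, proof L10–11) with Thm. 24.94 (p. 566) and Cor. 24.100 (p. 568)] -/
theorem grothendieckExistence_general ⦃A : Type u⦄ [CommRing A] [IsNoetherianRing A] (I : Ideal A)
    [IsAdicComplete I A] ⦃X : Scheme.{u}⦄ (f : X ⟶ Spec (.of A)) [IsProper f]
    (T : ℕ → Scheme.{u}) (j : ∀ n, T n ⟶ infinitesimalNeighbourhood I f n)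
    (s : ∀ n, T n ⟶ T (n + 1)) (hj : ∀ n, IsClosedImmersion (j n))
    (hs : ∀ n, IsPullback (s n) (j n) (j (n + 1)) (transition I f n)) :
    ∃ (T' : Scheme.{u}) (i : T' ⟶ X), IsClosedImmersion i ∧
      ∃ r : ∀ n, T n ⟶ T', ∀ n, IsPullback (r n) (j n) i (ι I f n) := by
  haveI := hj
  haveI := isClosedImmersion_transition I f
  let K : ℕ → X.IdealSheafData := fun n => (j n ≫ ι I f n).ker
  have hK : ∀ n, K n = K (n + 1) ⊔ extIdeal f I ^ (n + 1) := fun n => by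
    change (j n ≫ ι _ f n).ker = (j (n + 1) ≫ ι _ f (n + 1)).ker ⊔ _
    rw [← ker_ι_eq_extIdeal_pow f I n, ← transition_ι I f n]
    exact ker_comp_eq_sup_of_isPullback (j n) (j (n + 1)) (transition _ f n) (ι _ f (n + 1)) (s n) (hs n)
  obtain ⟨K', hK', -⟩ := existsUnique_idealSheaf_forall_eq_sup_extIdeal f I K hK
  have hle : ∀ n, K'.subschemeι.ker ≤ (j n ≫ ι I f n).ker := fun n => by
    rw [ker_subschemeι]
    change K' ≤ K n
    rw [hK' n]
    exact le_sup_left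
  refine ⟨K'.subscheme, K'.subschemeι, inferInstance,
    fun n => IsClosedImmersion.lift K'.subschemeι (j n ≫ ι I f n) (hle n), fun n => ?_⟩
  refine (isPullback_of_isClosedImmersion (j n) K'.subschemeι _ (ι I f n)
    (IsClosedImmersion.lift_fac _ _ _).symm ?_).flip
  rw [ker_subschemeι, ← comap_map_of_isClosedImmersion (ι I f n) (j n).ker, map_ker]
  change K'.comap _ = (K n).comap _
  rw [hK' n, comap_sup, ← ker_ι_eq_extIdeal_pow f I n, ← map_bot (ι I f n), comap_map_of_isClosedImmersion,
    sup_bot_eq]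

/-- **F-88 HOLDS**: the tree's NAMED FACT `Literature.AlgebraicGeometry.FormalGeometry.GrothendieckExistence` (FACT-LIST F-88) is a
THEOREM (every universe). [cite: GortzWedhorn2023, Prop. 24.109 (p. 577)] -/
theorem grothendieckExistence_holds : Literature.AlgebraicGeometry.FormalGeometry.GrothendieckExistence.{u} := by
  intro A _ _ I _ X f _ T j s hj hs
  exact grothendieckExistence_general I f T j s hj hs

/-- **DISCHARGE OF THE NAMED FACT F-88 under its canonical name** `GrothendieckExistence_holds` (lean/CONVENTIONS.md §4:
«DISCHARGING the fact = landing `theorem FooTheorem_holds : FooTheorem`»; declared with its absolute Literature name from this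
Summits-side file, as the tree does for e.g. `Literature.Analysis.PDE.divFormStrongMaximumPrinciple_holds` — the proof cone lives under
`Summits/…/Theorems/EquisingularLiftEquisingularLiftNatGEPrincipal*`; a Literature re-homing of that cone is a librarian task).
[cite: GortzWedhorn2023, Prop. 24.109 (p. 577, proof L10–11) with Thm. 24.94 (p. 566) and Cor. 24.100 (p. 568)] -/
theorem _root_.Literature.AlgebraicGeometry.FormalGeometry.GrothendieckExistence_holds :
    Literature.AlgebraicGeometry.FormalGeometry.GrothendieckExistence.{u} :=
  grothendieckExistence_holds

end Main

end GEPrincipal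

end Summit.ResolutionOfSingularities.ResolutionOfSingularities.Cruxes.EquisingularLiftNat.Sections

end
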